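import Mathlib
import Literature.Combinatorics.Optimization.SdpFormulationReductions
import Literature.Combinatorics.Optimization.MaxKXorSosGap
import Literature.Combinatorics.Optimization.ParityImpliedPredicateSosGap
import HarnessLib

/-!
# SDP formulation complexity of Boolean Max-CSPs (Braun–Pokutta–Zink currency for the Lee–Raghavendra–Steurer bounds)

Bridge between the two SDP-lower-bound vocabularies of this directory:

* Lee–Raghavendra–Steurer 2015 (`SDPRelaxationsMaxCSP.lean`): Max-`𝒫_n` instances `CSPInstance k n 𝒫`,
  normalised objective `ℑ(x) ∈ [0,1]`, "a subspace `U` achieves a `(c,s)`-approximation"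
  (`AchievesApprox`), the instance/solution matrix `M^{n,𝒫}_{c,s}(ℑ,x) = c − ℑ(x)` (`cspMatrix`) and
  Prop. 1.13 (`rk_psd(M)² ≥ dim U ≥ rk_psd(M)`, PROVED in the tree);
* Braun–Pokutta–Zink 2015 / Braun–Pokutta–Roy 2016 (`SymmetricSDPMatching.lean`,
  `SDPFormulationFactorization.lean`, `SdpFormulationReductions.lean`): maximization problems
  `MaxProblem σ φ` with guarantees `(C,S)`, `(C,S)`-approximate SDP formulations of size `d`
  (`SDPFormulation P d`), the slack matrix `M_{𝒫,C,S}` and the factorization theorem.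

PROVED here (no named facts):

* `cspProblem k n 𝒫 c s` — Max-`𝒫_n` AS a Braun–Pokutta–Zink maximization problem: feasible solutions
  `x ∈ {0,1}ⁿ`, instances `ℑ`, `val_ℑ(x) = ℑ(x)`, guarantees `C ≡ c`, `S ≡ s` (BPR16 Def. 2.8 "CSPs …
  `val_ℑ(s)` = weighted fraction of satisfied clauses", with the guarantees written as fractions,
  `fc_⊕(𝒫, c, s)`); its sound instances are exactly `Π_n^{≤ s}` and its slack matrix IS `M^{n,𝒫}_{c,s}`
  (`hasPsdFactorization_cspProblem_iff`) — LRS Prop. 6.1's identification "SDP relaxations of size `r` ↔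
  `rk_psd(M^{n,𝒫}_{c,s}) ≤ r`", here for BPZ's general SDP formulations.
* `SDPFormulation.csp_exists_achievesApprox` — an SDP formulation of Max-`𝒫_n` of size `d` with
  guarantees `(c,s)` yields a subspace of dimension `≤ (d+1)²` achieving a `(c,s)`-approximation
  (factorization theorem + LRS Prop. 1.13); contrapositive `isEmpty_sdpFormulation_csp`.
* The tree's Lee–Raghavendra–Steurer × Schoenebeck theorems in `fc_⊕` currency
  (`sdpFormulation_quasipoly_of_subspace`, `sdpFormulation_poly_of_subspace` do the bookkeeping
  `d ≤ n^{γ log n/log log n} ⇒ (d+1)² ≤ n^{4γ log n/log log n}`):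
  - `maxKXor_sdpFormulation_quasipoly` / `_poly` — for every `k ≥ 3` there is `γ > 0` such that for all
    `1/2 < s < c < 1` and all large `n`, Max-`k`-XOR on `n` variables has NO `(c,s)`-approximate SDP
    formulation of size `≤ n^{γ log n / log log n}`; in particular none of size `n^C`.  This is the base
    hard problem "`fc_⊕(Max-3-XOR, 1 − ε, 1/2 + δ) = m^{Ω(log m/log log m)}`" of
    [cite: BraunPokuttaRoy2016, eq. (7.2) in the proof of Thm. 7.1 (arXiv v3)] (there attributed to
    LRS Thm. 6.4 + Schoenebeck Thm. 4.5; here a THEOREM, for every large `m` rather than infinitely many,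
    and for every `k ≥ 3`), the SDP analogue of [cite: BraunPokuttaZink2015, Thm. 4.5].
  - `maxKSat_sdpFormulation_quasipoly` / `_poly` — the same for Max-`k`-SAT with `1 − 2^{−k} < s < c < 1`
    (LRS Thm. 1.5: "Max 3-Sat is SDP-hard to approximate within any factor better than `7/8`", as quoted
    in [cite: BraunPokuttaZink2015, §4 before Conj. 4.6]).
  - `parityImplied_sdpFormulation_quasipoly` / `_poly` — the same for Max-CSP(`P`) with literals, `P` any
    `k`-ary predicate implied by parity, `|P⁻¹(1)|/2^k < s < c < 1`.
-/

noncomputable section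

open Finset Matrix Real Filter

namespace Literature.Combinatorics.Optimization

variable {k n : ℕ} {P : Set ((Fin k → Bool) → Bool)} {c s : ℝ}

/-! ### Max-`𝒫_n` as a Braun–Pokutta–Zink maximization problem -/

/-- **Max-`𝒫_n` with guarantees `(c, s)` as a maximization problem** in the sense of Braun–Pokutta–Zink:
feasible solutions = assignments `x ∈ {0,1}ⁿ`, instances = Max-`𝒫` instances `ℑ` on `n` variables,
`val_ℑ(x) = ℑ(x)` (fraction of satisfied constraints), completeness guarantee `C(ℑ) = c`, soundness
guarantee `S(ℑ) = s`. [cite: BraunPokuttaRoy2016, Def. 2.8 and Def. 2.24 (arXiv v3)]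
[cite: LeeRaghavendraSteurer2015, §6.1 (p. 24–25)] -/
def cspProblem (k n : ℕ) (P : Set ((Fin k → Bool) → Bool)) (c s : ℝ) :
    MaxProblem (Fin n → Bool) (CSPInstance k n P) where
  val I x := I.val x
  C _ := c
  S _ := s

/-- The value of `cspProblem`. [cite: BraunPokuttaRoy2016, Def. 2.8 (arXiv v3)] -/
@[simp] theorem cspProblem_val (I : CSPInstance k n P) (x : Fin n → Bool) :
    (cspProblem k n P c s).val I x = I.val x := rfl

/-- The completeness guarantee of `cspProblem`. [cite: BraunPokuttaRoy2016, Def. 2.24 (arXiv v3)] -/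
@[simp] theorem cspProblem_C (I : CSPInstance k n P) : (cspProblem k n P c s).C I = c := rfl

/-- The soundness guarantee of `cspProblem`. [cite: BraunPokuttaRoy2016, Def. 2.24 (arXiv v3)] -/
@[simp] theorem cspProblem_S (I : CSPInstance k n P) : (cspProblem k n P c s).S I = s := rfl

/-- The sound instances of `cspProblem k n 𝒫 c s` ("`max val_ℑ ≤ S(ℑ)`") are exactly the instances with
`opt(ℑ) ≤ s`, i.e. the row set `Π_n^{≤ s}` of `M^{n,𝒫}_{c,s}`.
[cite: BraunPokuttaRoy2016, Def. 2.24 (arXiv v3)] [cite: LeeRaghavendraSteurer2015, Prop. 1.13 (p. 8)] -/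
theorem cspProblem_sound_iff (I : CSPInstance k n P) : (cspProblem k n P c s).Sound I ↔ I.OptLE s :=
  Iff.rfl

/-- **The slack matrix of Max-`𝒫_n` with guarantees `(c,s)` is `M^{n,𝒫}_{c,s}`** (same entries
`c − ℑ(x)`, same rows `Π_n^{≤ s}`): psd factorizations of one are psd factorizations of the other.
[cite: LeeRaghavendraSteurer2015, §6.1 and Prop. 6.1 (p. 25)] [cite: BraunPokuttaRoy2016, Def. 2.25 (arXiv v3)] -/
theorem hasPsdFactorization_cspProblem_iff {r : ℕ} :
    HasPsdFactorization (cspProblem k n P c s).slackMatrix r ↔ HasPsdFactorization (cspMatrix k n P c s) r :=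
  ⟨fun h => h.submatrix
      (fun I : SoundInstances k n P s => (⟨I.1, I.2⟩ : {I : CSPInstance k n P // (cspProblem k n P c s).Sound I}))
      id,
   fun h => h.submatrix
      (fun I : {I : CSPInstance k n P // (cspProblem k n P c s).Sound I} => (⟨I.1, I.2⟩ : SoundInstances k n P s))
      id⟩

/-- **An SDP formulation of Max-`𝒫_n` of size `d` gives an achieving subspace of dimension `≤ (d+1)²`:**
the factorization theorem (`C(ℑ) − ℑ(x) = Tr[A_ℑ B_x]`, size `d+1`) followed by LRS Prop. 1.13
(the span of the entries of `x ↦ B_x^{1/2}` achieves a `(c,s)`-approximation).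
[cite: BraunPokuttaRoy2016, Thm. 2.26 (arXiv v3)] [cite: LeeRaghavendraSteurer2015, Prop. 1.13 (p. 8–9)] -/
theorem SDPFormulation.csp_exists_achievesApprox {d : ℕ} (E : SDPFormulation (cspProblem k n P c s) d) :
    ∃ U : Submodule ℝ ((Fin n → Bool) → ℝ),
      AchievesApprox P (U : Set ((Fin n → Bool) → ℝ)) c s ∧ Module.finrank ℝ U ≤ (d + 1) ^ 2 :=
  (hasPsdFactorization_cspProblem_iff.1 E.hasPsdFactorization_slackMatrix).exists_achievesApprox

/-- If no subspace of dimension `≤ r²` achieves a `(c,s)`-approximation of Max-`𝒫_n`, then `M^{n,𝒫}_{c,s}`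
has no psd factorization of size `r` (LRS Prop. 1.13, contrapositive).
[cite: LeeRaghavendraSteurer2015, Prop. 1.13 (p. 8–9)] -/
theorem not_hasPsdFactorization_cspMatrix_of_subspace {r : ℕ}
    (h : ∀ U : Submodule ℝ ((Fin n → Bool) → ℝ), Module.finrank ℝ U ≤ r ^ 2 →
      ¬ AchievesApprox P (U : Set ((Fin n → Bool) → ℝ)) c s) :
    ¬ HasPsdFactorization (cspMatrix k n P c s) r := by
  intro hf
  obtain ⟨U, hU, hdim⟩ := hf.exists_achievesApprox
  exact h U hdim hU

/-- The same for the BPZ slack matrix of `cspProblem`.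
[cite: LeeRaghavendraSteurer2015, Prop. 1.13 (p. 8–9)] [cite: BraunPokuttaRoy2016, Def. 2.25 (arXiv v3)] -/
theorem not_hasPsdFactorization_cspProblem_of_subspace {r : ℕ}
    (h : ∀ U : Submodule ℝ ((Fin n → Bool) → ℝ), Module.finrank ℝ U ≤ r ^ 2 →
      ¬ AchievesApprox P (U : Set ((Fin n → Bool) → ℝ)) c s) :
    ¬ HasPsdFactorization (cspProblem k n P c s).slackMatrix r :=
  fun hf => not_hasPsdFactorization_cspMatrix_of_subspace h (hasPsdFactorization_cspProblem_iff.1 hf)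

/-- **No small subspace achieves ⇒ no small SDP formulation:** if no subspace of dimension `≤ (d+1)²`
achieves a `(c,s)`-approximation of Max-`𝒫_n`, then Max-`𝒫_n` has no `(c,s)`-approximate SDP formulation
of size `d`. [cite: BraunPokuttaRoy2016, Thm. 2.26 (arXiv v3)] [cite: LeeRaghavendraSteurer2015, Prop. 1.13 (p. 8–9)] -/
theorem isEmpty_sdpFormulation_csp {d : ℕ}
    (h : ∀ U : Submodule ℝ ((Fin n → Bool) → ℝ), Module.finrank ℝ U ≤ (d + 1) ^ 2 →
      ¬ AchievesApprox P (U : Set ((Fin n → Bool) → ℝ)) c s) :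
    IsEmpty (SDPFormulation (cspProblem k n P c s) d) :=
  ⟨fun E => by
    obtain ⟨U, hU, hdim⟩ := E.csp_exists_achievesApprox
    exact h U hdim hU⟩

/-! ### Bookkeeping: `d ≤ n^{γ log n/log log n}` versus `dim U ≤ (d+1)²` -/

/-- For `n ≥ 16` and `a ≥ 0`: `n^a ≤ n^{a log n / log log n}` (since `log log n ≤ log n`). [folklore] -/
private theorem rpow_le_rpow_log_div_loglog {n : ℕ} (hn : 16 ≤ n) {a : ℝ} (ha : 0 ≤ a) :
    (n : ℝ) ^ a ≤ (n : ℝ) ^ (a * Real.log n / Real.log (Real.log n)) := by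
  have hn1 : (1 : ℝ) < n := by exact_mod_cast lt_of_lt_of_le (by norm_num) hn
  have hn16 : (16 : ℝ) ≤ n := by exact_mod_cast hn
  have hlog : 1 < Real.log n := by
    rw [← Real.exp_lt_exp, Real.exp_log (by linarith)]
    exact lt_of_lt_of_le (lt_trans Real.exp_one_lt_d9 (by norm_num)) hn16
  have hll : 0 < Real.log (Real.log n) := Real.log_pos hlog
  have hll_le : Real.log (Real.log n) ≤ Real.log n :=
    (Real.log_le_sub_one_of_pos (by linarith)).trans (by linarith)
  apply Real.rpow_le_rpow_of_exponent_le hn1.le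
  rw [le_div_iff₀ hll]
  exact mul_le_mul_of_nonneg_left hll_le ha

/-- Bookkeeping for the quasi-polynomial statements: for `n ≥ 16`, `n^{α/2} ≥ 4`, `α > 0` and
`d ≤ n^{(α/4) log n/log log n}` we have `(d+1)² ≤ n^{α log n / log log n}`. [folklore] -/
private theorem sq_succ_le_of_le_rpow {n d : ℕ} (hn : 16 ≤ n) {α : ℝ} (hα : 0 < α)
    (h4 : (4 : ℝ) ≤ (n : ℝ) ^ (α / 2))
    (hd : (d : ℝ) ≤ (n : ℝ) ^ (α / 4 * Real.log n / Real.log (Real.log n))) :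
    (((d + 1) ^ 2 : ℕ) : ℝ) ≤ (n : ℝ) ^ (α * Real.log n / Real.log (Real.log n)) := by
  have hn0 : (0 : ℝ) < n := by exact_mod_cast lt_of_lt_of_le (by norm_num) hn
  set L : ℝ := Real.log n / Real.log (Real.log n) with hL
  have hexp : ∀ b : ℝ, b * Real.log n / Real.log (Real.log n) = b * L := fun b => by
    rw [hL]; ring
  rw [hexp] at hd ⊢
  have hN1 : (1 : ℝ) ≤ (n : ℝ) ^ (α / 4 * L) := by
    refine Real.one_le_rpow (by exact_mod_cast le_trans (by norm_num) hn) ?_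
    have := rpow_le_rpow_log_div_loglog hn (le_of_lt (by positivity : (0:ℝ) < α / 4))
    rw [hexp] at this
    -- `0 ≤ α/4 · L` since `n^{α/4·L} ≥ n^{α/4} ≥ 1 > 0`; directly: `L ≥ 0`
    have hLnn : 0 ≤ L := by
      rw [hL]
      have hn1 : (1 : ℝ) < n := by exact_mod_cast lt_of_lt_of_le (by norm_num) hn
      have hlog : 1 < Real.log n := by
        rw [← Real.exp_lt_exp, Real.exp_log hn0]
        exact lt_of_lt_of_le (lt_trans Real.exp_one_lt_d9 (by norm_num))
          (by exact_mod_cast hn : (16 : ℝ) ≤ n)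
      exact div_nonneg (by linarith) (Real.log_pos hlog).le
    positivity
  -- `(d+1)² ≤ (2 n^{α/4 L})² = 4 n^{α/2 L} ≤ n^{α/2} n^{α/2 L} ≤ n^{α/2 L} n^{α/2 L} = n^{α L}`
  have hd1 : ((d : ℝ) + 1) ≤ 2 * (n : ℝ) ^ (α / 4 * L) := by linarith
  have hsq : ((d : ℝ) + 1) ^ 2 ≤ 4 * (n : ℝ) ^ (α / 2 * L) := by
    have h2 : (2 * (n : ℝ) ^ (α / 4 * L)) ^ 2 = 4 * (n : ℝ) ^ (α / 2 * L) := by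
      rw [mul_pow, ← Real.rpow_natCast ((n : ℝ) ^ (α / 4 * L)) 2, ← Real.rpow_mul hn0.le]
      norm_num; ring_nf
    rw [← h2]
    exact pow_le_pow_left₀ (by positivity) hd1 2
  have hhalf : (n : ℝ) ^ (α / 2) ≤ (n : ℝ) ^ (α / 2 * L) := by
    have := rpow_le_rpow_log_div_loglog hn (le_of_lt (by positivity : (0:ℝ) < α / 2))
    rwa [hexp] at this
  push_cast
  calc ((d : ℝ) + 1) ^ 2 ≤ 4 * (n : ℝ) ^ (α / 2 * L) := hsq
    _ ≤ (n : ℝ) ^ (α / 2) * (n : ℝ) ^ (α / 2 * L) := by gcongr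
    _ ≤ (n : ℝ) ^ (α / 2 * L) * (n : ℝ) ^ (α / 2 * L) := by gcongr
    _ = (n : ℝ) ^ (α * L) := by rw [← Real.rpow_add hn0]; ring_nf

/-- **From "no subspace of dimension `≤ n^{α log n/log log n}` achieves" to "no SDP formulation of size
`≤ n^{(α/4) log n/log log n}`"** (factorization theorem + Prop. 1.13 + bookkeeping).
[cite: BraunPokuttaRoy2016, Thm. 2.26 (arXiv v3)] [cite: LeeRaghavendraSteurer2015, Prop. 1.13 and Thm. 1.5 (p. 6–9)] -/
theorem sdpFormulation_quasipoly_of_subspace {α : ℝ} (hα : 0 < α)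
    (h : ∃ n₀ : ℕ, ∀ n : ℕ, n₀ ≤ n → ∀ U : Submodule ℝ ((Fin n → Bool) → ℝ),
      (Module.finrank ℝ U : ℝ) ≤ (n : ℝ) ^ (α * Real.log n / Real.log (Real.log n)) →
      ¬ AchievesApprox P (U : Set ((Fin n → Bool) → ℝ)) c s) :
    ∃ n₀ : ℕ, ∀ n : ℕ, n₀ ≤ n → ∀ d : ℕ,
      (d : ℝ) ≤ (n : ℝ) ^ (α / 4 * Real.log n / Real.log (Real.log n)) →
      IsEmpty (SDPFormulation (cspProblem k n P c s) d) := by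
  obtain ⟨n₀, H⟩ := h
  -- threshold: `n ≥ n₀`, `n ≥ 16`, `n^{α/2} ≥ 4`
  obtain ⟨n₁, hn₁⟩ : ∃ n₁ : ℕ, ∀ n : ℕ, n₁ ≤ n → (4 : ℝ) ≤ (n : ℝ) ^ (α / 2) := by
    have ht : Tendsto (fun n : ℕ => (n : ℝ) ^ (α / 2)) atTop atTop :=
      (tendsto_rpow_atTop (by positivity)).comp tendsto_natCast_atTop_atTop
    obtain ⟨n₁, hn₁⟩ := eventually_atTop.1 (ht.eventually_ge_atTop 4)
    exact ⟨n₁, hn₁⟩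
  refine ⟨max (max n₀ 16) n₁, fun n hn d hd => isEmpty_sdpFormulation_csp fun U hU => ?_⟩
  have hn₀ : n₀ ≤ n := le_trans (le_max_left _ _) (le_trans (le_max_left _ _) hn)
  have hn16 : 16 ≤ n := le_trans (le_max_right _ _) (le_trans (le_max_left _ _) hn)
  have hnn₁ : n₁ ≤ n := le_trans (le_max_right _ _) hn
  refine H n hn₀ U (le_trans ?_ (sq_succ_le_of_le_rpow hn16 hα (hn₁ n hnn₁) hd))
  exact_mod_cast hU

/-- Polynomial bookkeeping: for `n ≥ 4`, `d ≤ n^C` implies `(d+1)² ≤ n^{2C+1}`. [folklore] -/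
private theorem sq_succ_le_pow {n d C : ℕ} (hn : 4 ≤ n) (hd : (d : ℝ) ≤ (n : ℝ) ^ C) :
    (((d + 1) ^ 2 : ℕ) : ℝ) ≤ (n : ℝ) ^ (2 * C + 1) := by
  have hn4 : (4 : ℝ) ≤ n := by exact_mod_cast hn
  have h1 : (1 : ℝ) ≤ (n : ℝ) ^ C := one_le_pow₀ (by linarith)
  have hd1 : ((d : ℝ) + 1) ≤ 2 * (n : ℝ) ^ C := by linarith
  push_cast
  calc ((d : ℝ) + 1) ^ 2 ≤ (2 * (n : ℝ) ^ C) ^ 2 := pow_le_pow_left₀ (by positivity) hd1 2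
    _ = 4 * ((n : ℝ) ^ C) ^ 2 := by ring
    _ ≤ (n : ℝ) * ((n : ℝ) ^ C) ^ 2 := by gcongr
    _ = (n : ℝ) ^ (2 * C + 1) := by ring

/-- **From "no subspace of dimension `≤ n^C` achieves (every `C`)" to "no SDP formulation of size `≤ n^C`
(every `C`)".** [cite: BraunPokuttaRoy2016, Thm. 2.26 (arXiv v3)]
[cite: LeeRaghavendraSteurer2015, Prop. 1.13 and Thm. 1.6 (p. 6–9)] -/
theorem sdpFormulation_poly_of_subspace
    (h : ∀ C : ℕ, ∃ n₀ : ℕ, ∀ n : ℕ, n₀ ≤ n → ∀ U : Submodule ℝ ((Fin n → Bool) → ℝ),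
      (Module.finrank ℝ U : ℝ) ≤ (n : ℝ) ^ C → ¬ AchievesApprox P (U : Set ((Fin n → Bool) → ℝ)) c s) :
    ∀ C : ℕ, ∃ n₀ : ℕ, ∀ n : ℕ, n₀ ≤ n → ∀ d : ℕ, (d : ℝ) ≤ (n : ℝ) ^ C →
      IsEmpty (SDPFormulation (cspProblem k n P c s) d) := by
  intro C
  obtain ⟨n₀, H⟩ := h (2 * C + 1)
  refine ⟨max n₀ 4, fun n hn d hd => isEmpty_sdpFormulation_csp fun U hU => ?_⟩
  have hn₀ : n₀ ≤ n := le_trans (le_max_left _ _) hn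
  have hn4 : 4 ≤ n := le_trans (le_max_right _ _) hn
  refine H n hn₀ U (le_trans ?_ (sq_succ_le_pow hn4 hd))
  exact_mod_cast hU

/-! ### Max-`k`-XOR, Max-`k`-SAT and parity-implied predicates in `fc_⊕` currency -/

/-- **Max-`k`-XOR has no quasi-polynomial SDP formulation beating `1/2`** (every `k ≥ 3`): there is
`γ > 0` such that for all `1/2 < s < c < 1` and all large `n`, Max-`k`-XOR on `n` variables has no
`(c,s)`-approximate SDP formulation (in the sense of Braun–Pokutta–Zink) of size `≤ n^{γ log n/log log n}`.
The base hard problem "`fc_⊕(Max-3-XOR, 1−ε, 1/2+δ) = m^{Ω(log m/log log m)}`" of Braun–Pokutta–Roy's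
MaxCUT theorem, as a THEOREM of the tree (LRS Thm. 6.4/1.5 × Schoenebeck, `LeeRaghavendraSteurer2015_maxKXor_quasipoly`).
[cite: BraunPokuttaRoy2016, eq. (7.2), proof of Thm. 7.1 (arXiv v3)]
[cite: LeeRaghavendraSteurer2015, Thm. 1.5 and Thm. 6.4 (p. 6, 25–27)] [cite: Schoenebeck2008, §3] -/
theorem maxKXor_sdpFormulation_quasipoly (hk : 3 ≤ k) :
    ∃ γ : ℝ, 0 < γ ∧ ∀ s : ℝ, 1 / 2 < s → ∀ c : ℝ, s < c → c < 1 →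
      ∃ n₀ : ℕ, ∀ n : ℕ, n₀ ≤ n → ∀ d : ℕ,
        (d : ℝ) ≤ (n : ℝ) ^ (γ * Real.log n / Real.log (Real.log n)) →
        IsEmpty (SDPFormulation (cspProblem k n (literalClosure (xorK k)) c s) d) := by
  obtain ⟨α, hα, H⟩ := LeeRaghavendraSteurer2015_maxKXor_quasipoly hk
  exact ⟨α / 4, by positivity, fun s hs c hsc hc1 =>
    sdpFormulation_quasipoly_of_subspace hα (H s hs c hsc hc1)⟩

/-- **Max-`k`-XOR has no polynomial-size SDP formulation beating `1/2`** (every `k ≥ 3`, all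
`1/2 < s`, `c < 1`, every exponent `C`, all large `n`).
[cite: BraunPokuttaZink2015, Thm. 4.5 (SDP analogue) and Conj. 4.6 discussion]
[cite: LeeRaghavendraSteurer2015, Thm. 1.6 (p. 6)] [cite: Schoenebeck2008, §3] -/
theorem maxKXor_sdpFormulation_poly (hk : 3 ≤ k) :
    ∀ s : ℝ, 1 / 2 < s → ∀ c : ℝ, c < 1 → ∀ C : ℕ, ∃ n₀ : ℕ, ∀ n : ℕ, n₀ ≤ n → ∀ d : ℕ,
      (d : ℝ) ≤ (n : ℝ) ^ C → IsEmpty (SDPFormulation (cspProblem k n (literalClosure (xorK k)) c s) d) :=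
  fun s hs c hc => sdpFormulation_poly_of_subspace (LeeRaghavendraSteurer2015_maxKXor_poly hk s hs c hc)

/-- **Max-`k`-SAT has no quasi-polynomial SDP formulation beating `1 − 2^{−k}`** (every `k ≥ 3`; for
`k = 3`: "SDP-hard to approximate within any factor better than `7/8`"): `γ > 0` with no
`(c,s)`-approximate SDP formulation of size `≤ n^{γ log n/log log n}` for `1 − 2^{−k} < s < c < 1`, `n` large.
[cite: LeeRaghavendraSteurer2015, Thm. 1.5 (p. 6)] [cite: BraunPokuttaZink2015, §4 (remark before Conj. 4.6)]
[cite: Schoenebeck2008, §5] -/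
theorem maxKSat_sdpFormulation_quasipoly (hk : 3 ≤ k) :
    ∃ γ : ℝ, 0 < γ ∧ ∀ s : ℝ, 1 - 1 / 2 ^ k < s → ∀ c : ℝ, s < c → c < 1 →
      ∃ n₀ : ℕ, ∀ n : ℕ, n₀ ≤ n → ∀ d : ℕ,
        (d : ℝ) ≤ (n : ℝ) ^ (γ * Real.log n / Real.log (Real.log n)) →
        IsEmpty (SDPFormulation (cspProblem k n (maxKSatPreds k) c s) d) := by
  obtain ⟨α, hα, H⟩ := LeeRaghavendraSteurer2015_maxKSat_quasipoly hk
  exact ⟨α / 4, by positivity, fun s hs c hsc hc1 =>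
    sdpFormulation_quasipoly_of_subspace hα (H s hs c hsc hc1)⟩

/-- **Max-`k`-SAT has no polynomial-size SDP formulation beating `1 − 2^{−k}`** (every `k ≥ 3`).
[cite: LeeRaghavendraSteurer2015, Thm. 1.6 and the paragraph after it (p. 6)] [cite: Schoenebeck2008, §5] -/
theorem maxKSat_sdpFormulation_poly (hk : 3 ≤ k) :
    ∀ s : ℝ, 1 - 1 / 2 ^ k < s → ∀ c : ℝ, c < 1 → ∀ C : ℕ, ∃ n₀ : ℕ, ∀ n : ℕ, n₀ ≤ n → ∀ d : ℕ,
      (d : ℝ) ≤ (n : ℝ) ^ C → IsEmpty (SDPFormulation (cspProblem k n (maxKSatPreds k) c s) d) :=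
  fun s hs c hc => sdpFormulation_poly_of_subspace (LeeRaghavendraSteurer2015_maxKSat_poly hk s hs c hc)

/-- **Parity-implied predicates** (`P⁻¹(1) ⊇ xor_k⁻¹(1)`, with literals, every `k ≥ 3`): `γ > 0` with no
`(c,s)`-approximate SDP formulation of Max-CSP(`P`) of size `≤ n^{γ log n/log log n}` for
`|P⁻¹(1)|/2^k < s < c < 1` and all large `n`.
[cite: LeeRaghavendraSteurer2015, Thm. 1.5 (p. 6)] [cite: Schoenebeck2008, Thm. 4.5 (arbitrary parity-implied predicate)] -/
theorem parityImplied_sdpFormulation_quasipoly (hk : 3 ≤ k) {Q : (Fin k → Bool) → Bool}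
    (hQ : ∀ y, xorK k y = true → Q y = true) :
    ∃ γ : ℝ, 0 < γ ∧
      ∀ s : ℝ, (((univ : Finset (Fin k → Bool)).filter fun y => Q y = true).card / 2 ^ k : ℝ) < s →
      ∀ c : ℝ, s < c → c < 1 →
      ∃ n₀ : ℕ, ∀ n : ℕ, n₀ ≤ n → ∀ d : ℕ,
        (d : ℝ) ≤ (n : ℝ) ^ (γ * Real.log n / Real.log (Real.log n)) →
        IsEmpty (SDPFormulation (cspProblem k n (literalClosure Q) c s) d) := by
  obtain ⟨α, hα, H⟩ := LeeRaghavendraSteurer2015_parityImplied_quasipoly hk hQ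
  exact ⟨α / 4, by positivity, fun s hs c hsc hc1 =>
    sdpFormulation_quasipoly_of_subspace hα (H s hs c hsc hc1)⟩

/-- **Parity-implied predicates, polynomial size.**
[cite: LeeRaghavendraSteurer2015, Thm. 1.6 (p. 6)] [cite: Schoenebeck2008, Thm. 4.5] -/
theorem parityImplied_sdpFormulation_poly (hk : 3 ≤ k) {Q : (Fin k → Bool) → Bool}
    (hQ : ∀ y, xorK k y = true → Q y = true) :
    ∀ s : ℝ, (((univ : Finset (Fin k → Bool)).filter fun y => Q y = true).card / 2 ^ k : ℝ) < s →
      ∀ c : ℝ, c < 1 → ∀ C : ℕ, ∃ n₀ : ℕ, ∀ n : ℕ, n₀ ≤ n → ∀ d : ℕ,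
      (d : ℝ) ≤ (n : ℝ) ^ C → IsEmpty (SDPFormulation (cspProblem k n (literalClosure Q) c s) d) :=
  fun s hs c hc =>
    sdpFormulation_poly_of_subspace (LeeRaghavendraSteurer2015_parityImplied_poly hk hQ s hs c hc)

end Literature.Combinatorics.Optimization

end
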